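import Mathlib.Analysis.InnerProductSpace.PiL2
import Mathlib.Analysis.InnerProductSpace.Calculus
import Mathlib.Analysis.SpecialFunctions.ExpDeriv
import HarnessLib

/-!
# Lemmas for E. Hopf's strong minimum principle, II: the barrier `e^{-α|x-z|²}`

The comparison function of E. Hopf's proof (López-Gómez, *Linear Second Order Elliptic
Operators*, 2012, (1.19)): `v(x) = e^{-α|x - z|²} - e^{-αρ²/4}`. This file computes the first and
second Fréchet derivatives of the bump `hopfBump α z x = e^{-α|x - z|²}` on a real inner product
space and, in coordinates on `EuclideanSpace ℝ (Fin N)`, the value of a linear operator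
`𝔏 = -aᵢⱼ∂ᵢⱼ + bᵢ∂ᵢ + c` on it:

* `hasFDerivAt_hopfBump`, `fderiv_hopfBump_apply` — `Dv(x)ξ = -2α⟨x - z, ξ⟩ v(x)`;
* `hasFDerivAt_fderiv_hopfBump_apply`, `fderiv_fderiv_hopfBump_apply` —
  `D²v(x)(ξ, η) = (4α²⟨x - z, ξ⟩⟨x - z, η⟩ - 2α⟨ξ, η⟩) v(x)`;
* `contDiff_hopfBump`;
* `linearOp_hopfBump` — `𝔏(e^{-α|x-z|²}) = e^{-α|x-z|²} (-4α² ∑ aᵢⱼ(xᵢ-zᵢ)(xⱼ-zⱼ) +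
  2α ∑ aᵢᵢ - 2α ∑ bᵢ(xᵢ - zᵢ) + c)` (López-Gómez, display after (1.20));
* `hopfBracket_le_neg_one` — the bracket is negative for `α` large when `a ≥ μ > 0` is
  uniformly elliptic, `|x - z| ≥ ρ/4` and the coefficients are bounded ((1.20)).

## References

* J. López-Gómez, *Linear Second Order Elliptic Operators*, World Scientific (2012; © 2013), Ch. 1,
  proof of Thm. 1.2, (1.19)–(1.20).
-/

noncomputable section

open Set Filter Topology

namespace Literature.Analysis.PDE

section Bump

variable {E : Type*} [NormedAddCommGroup E] [InnerProductSpace ℝ E]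

open RealInnerProductSpace

/-- E. Hopf's bump `v(x) = e^{-α‖x - z‖²}` centred at `z` with steepness `α`.
López-Gómez 2012, (1.19). [cite: LopezGomez2012, (1.19)] -/
def hopfBump (α : ℝ) (z : E) (x : E) : ℝ :=
  Real.exp (-α * ‖x - z‖ ^ 2)

omit [InnerProductSpace ℝ E] in
/-- The bump is positive. [folklore] -/
lemma hopfBump_pos (α : ℝ) (z x : E) : 0 < hopfBump α z x :=
  Real.exp_pos _

/-- `D(e^{-α‖x-z‖²}) = -2α e^{-α‖x-z‖²} ⟨x - z, ·⟩`. López-Gómez 2012, proof of Thm. 1.2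
(display after (1.20)). [cite: LopezGomez2012, proof of Thm. 1.2] -/
lemma hasFDerivAt_hopfBump (α : ℝ) (z x : E) :
    HasFDerivAt (hopfBump α z) ((-2 * α * hopfBump α z x) • innerSL ℝ (x - z)) x := by
  have h1 : HasFDerivAt (fun x : E ↦ ‖x - z‖ ^ 2)
      (2 • (innerSL ℝ (id x - z)).comp (ContinuousLinearMap.id ℝ E)) x :=
    ((hasFDerivAt_id x).sub_const z).norm_sq
  have h3 := (h1.const_mul (-α)).exp
  unfold hopfBump
  convert h3 using 1
  ext ξ
  simp [two_smul]
  ring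

/-- `D(e^{-α‖x-z‖²})(ξ) = -2α⟨x - z, ξ⟩ e^{-α‖x-z‖²}`. [cite: LopezGomez2012, proof of Thm. 1.2] -/
lemma fderiv_hopfBump_apply (α : ℝ) (z x ξ : E) :
    fderiv ℝ (hopfBump α z) x ξ = -2 * α * ⟪x - z, ξ⟫ * hopfBump α z x := by
  rw [(hasFDerivAt_hopfBump α z x).fderiv]
  simp only [FunLike.coe_smul, Pi.smul_apply, innerSL_apply_apply, smul_eq_mul]
  ring

/-- The bump is smooth. [folklore] -/
lemma contDiff_hopfBump (α : ℝ) (z : E) {n : WithTop ℕ∞} : ContDiff ℝ n (hopfBump α z) := by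
  unfold hopfBump
  exact Real.contDiff_exp.comp (contDiff_const.mul ((contDiff_norm_sq ℝ).comp
    (contDiff_id.sub contDiff_const)))

/-- `D(e^{-α‖x-z‖²})` is differentiable. [folklore] -/
lemma differentiableAt_fderiv_hopfBump (α : ℝ) (z x : E) :
    DifferentiableAt ℝ (fderiv ℝ (hopfBump α z)) x :=
  ((contDiff_hopfBump α z (n := 2)).fderiv_right (m := 1) (by norm_num)).differentiable
    (by simp) x

/-- The derivative of `y ↦ D(e^{-α‖y-z‖²})(η)` (product rule).
[cite: LopezGomez2012, proof of Thm. 1.2] -/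
lemma hasFDerivAt_fderiv_hopfBump_apply (α : ℝ) (z x η : E) :
    HasFDerivAt (fun y ↦ fderiv ℝ (hopfBump α z) y η)
      ((-2 * α * ⟪x - z, η⟫) • ((-2 * α * hopfBump α z x) • innerSL ℝ (x - z)) +
        hopfBump α z x • ((-2 * α) • innerSL ℝ η)) x := by
  have hfun : (fun y ↦ fderiv ℝ (hopfBump α z) y η) =
      fun y ↦ (-2 * α * ⟪y - z, η⟫) * hopfBump α z y :=
    funext fun y ↦ by rw [fderiv_hopfBump_apply]
  rw [hfun]
  have h0 : HasFDerivAt (fun y : E ↦ innerSL ℝ η (y - z))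
      ((innerSL ℝ η).comp (ContinuousLinearMap.id ℝ E)) x :=
    (innerSL ℝ η).hasFDerivAt.comp x ((hasFDerivAt_id x).sub_const z)
  rw [ContinuousLinearMap.comp_id] at h0
  have h0' : HasFDerivAt (fun y : E ↦ ⟪y - z, η⟫) (innerSL ℝ η) x := by
    convert h0 using 2 with y
    rw [innerSL_apply_apply, real_inner_comm]
  exact (h0'.const_mul (-2 * α)).mul (hasFDerivAt_hopfBump α z x)

/-- `D²(e^{-α‖x-z‖²})(ξ, η) = (4α²⟨x - z, ξ⟩⟨x - z, η⟩ - 2α⟨ξ, η⟩) e^{-α‖x-z‖²}`.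
López-Gómez 2012, proof of Thm. 1.2 (second display after (1.20)).
[cite: LopezGomez2012, proof of Thm. 1.2] -/
lemma fderiv_fderiv_hopfBump_apply (α : ℝ) (z x ξ η : E) :
    fderiv ℝ (fderiv ℝ (hopfBump α z)) x ξ η =
      (4 * α ^ 2 * ⟪x - z, ξ⟫ * ⟪x - z, η⟫ - 2 * α * ⟪ξ, η⟫) * hopfBump α z x := by
  have hd : HasFDerivAt (fderiv ℝ (hopfBump α z)) (fderiv ℝ (fderiv ℝ (hopfBump α z)) x) x :=
    (differentiableAt_fderiv_hopfBump α z x).hasFDerivAt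
  have h1 := hd.clm_apply (hasFDerivAt_const η x)
  have heq := h1.unique (hasFDerivAt_fderiv_hopfBump_apply α z x η)
  have := congrArg (fun L : E →L[ℝ] ℝ ↦ L ξ) heq
  simp only [_root_.add_apply, ContinuousLinearMap.comp_apply,
    ContinuousLinearMap.flip_apply, FunLike.coe_smul, Pi.smul_apply, smul_eq_mul,
    innerSL_apply_apply] at this
  simp only [_root_.zero_apply, map_zero, zero_add] at this
  rw [this, real_inner_comm ξ η]
  ring

end Bump

/-! ### The bump in coordinates -/

section Coordinates

variable {N : ℕ}

open RealInnerProductSpace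

/-- `⟨v, eᵢ⟩ = vᵢ` on `EuclideanSpace ℝ (Fin N)`. [folklore] -/
lemma inner_single_one_right (v : EuclideanSpace ℝ (Fin N)) (i : Fin N) :
    ⟪v, EuclideanSpace.single i (1 : ℝ)⟫ = v i := by
  rw [EuclideanSpace.inner_single_right]
  simp

/-- **`𝔏` on the bump** (López-Gómez 2012, proof of Thm. 1.2, the display computing `𝔏v`):
`-∑ aᵢⱼ ∂ᵢⱼv + ∑ bᵢ ∂ᵢv + c v = v · (-4α² ∑ aᵢⱼ (xᵢ - zᵢ)(xⱼ - zⱼ) + 2α ∑ aᵢᵢ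
- 2α ∑ bᵢ (xᵢ - zᵢ) + c)` for `v = e^{-α‖x-z‖²}`. [cite: LopezGomez2012, proof of Thm. 1.2] -/
theorem linearOp_hopfBump (α : ℝ) (z x : EuclideanSpace ℝ (Fin N)) (a : Fin N → Fin N → ℝ)
    (b : Fin N → ℝ) (c : ℝ) :
    -(∑ i, ∑ j, a i j * fderiv ℝ (fderiv ℝ (hopfBump α z)) x (EuclideanSpace.single i 1)
        (EuclideanSpace.single j 1)) +
      ∑ i, b i * fderiv ℝ (hopfBump α z) x (EuclideanSpace.single i 1) + c * hopfBump α z x =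
    hopfBump α z x * (-4 * α ^ 2 * ∑ i, ∑ j, a i j * (x i - z i) * (x j - z j) +
      2 * α * ∑ i, a i i - 2 * α * ∑ i, b i * (x i - z i) + c) := by
  have hδ : ∀ i, ∑ j, a i j * (if j = i then (1 : ℝ) else 0) = a i i := fun i ↦ by
    simp [mul_ite, Finset.sum_ite_eq']
  have e0 : ∀ i j, fderiv ℝ (fderiv ℝ (hopfBump α z)) x (EuclideanSpace.single i 1)
      (EuclideanSpace.single j 1) = (4 * α ^ 2 * (x i - z i) * (x j - z j) -
        2 * α * (if j = i then (1 : ℝ) else 0)) * hopfBump α z x := fun i j ↦ by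
    rw [fderiv_fderiv_hopfBump_apply, inner_single_one_right, inner_single_one_right,
      inner_single_one_right, PiLp.sub_apply, PiLp.sub_apply, PiLp.single_apply]
  have e0' : ∀ i, fderiv ℝ (hopfBump α z) x (EuclideanSpace.single i 1) =
      -2 * α * (x i - z i) * hopfBump α z x := fun i ↦ by
    rw [fderiv_hopfBump_apply, inner_single_one_right, PiLp.sub_apply]
  simp only [e0, e0']
  have e1 : ∑ i, ∑ j, a i j * ((4 * α ^ 2 * (x i - z i) * (x j - z j) -
      2 * α * (if j = i then (1 : ℝ) else 0)) * hopfBump α z x) =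
      hopfBump α z x * (4 * α ^ 2 * ∑ i, ∑ j, a i j * (x i - z i) * (x j - z j)) -
        hopfBump α z x * (2 * α * ∑ i, a i i) := by
    rw [Finset.mul_sum, Finset.mul_sum, Finset.mul_sum, Finset.mul_sum, ← Finset.sum_sub_distrib]
    refine Finset.sum_congr rfl fun i _ ↦ ?_
    rw [Finset.mul_sum, Finset.mul_sum, ← hδ i, Finset.mul_sum, Finset.mul_sum,
      ← Finset.sum_sub_distrib]
    refine Finset.sum_congr rfl fun j _ ↦ ?_
    ring
  have e2 : ∑ i, b i * (-2 * α * (x i - z i) * hopfBump α z x) =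
      -(hopfBump α z x * (2 * α * ∑ i, b i * (x i - z i))) := by
    rw [Finset.mul_sum, Finset.mul_sum, ← Finset.sum_neg_distrib]
    refine Finset.sum_congr rfl fun i _ ↦ ?_
    ring
  rw [e1, e2]
  ring

/-- **The bracket is negative for large `α`** (López-Gómez 2012, (1.20) and the estimate
following it): if `∑ aᵢⱼ ξᵢ ξⱼ ≥ μ‖ξ‖²` with `μ > 0`, `‖x - z‖ ≥ ρ/4` with `ρ > 0`,
`|aᵢⱼ| ≤ C`, `|bᵢ| ≤ C`, `c ≤ C` and `‖x - z‖ ≤ R`, then for every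
`α ≥ max 1 ((8 N C + 8 N C R + 4 C + 4) · 4 / (μ ρ²))` the bracket
`-4α² ∑ aᵢⱼ(xᵢ-zᵢ)(xⱼ-zⱼ) + 2α ∑ aᵢᵢ - 2α ∑ bᵢ(xᵢ-zᵢ) + c` is `≤ -1`.
[cite: LopezGomez2012, (1.20)] -/
theorem hopfBracket_le_neg_one {μ ρ C R α : ℝ} {x z : EuclideanSpace ℝ (Fin N)}
    {a : Fin N → Fin N → ℝ} {b : Fin N → ℝ} {c : ℝ} (hμ : 0 < μ) (hρ : 0 < ρ) (hC : 0 ≤ C)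
    (hell : ∀ ξ : EuclideanSpace ℝ (Fin N), μ * ‖ξ‖ ^ 2 ≤ ∑ i, ∑ j, a i j * ξ i * ξ j)
    (ha : ∀ i j, |a i j| ≤ C) (hb : ∀ i, |b i| ≤ C) (hc : c ≤ C)
    (hfar : ρ / 4 ≤ ‖x - z‖) (hnear : ‖x - z‖ ≤ R)
    (hα : max 1 ((8 * N * C + 8 * N * C * R + 4 * C + 4) * 4 / (μ * ρ ^ 2)) ≤ α) :
    -4 * α ^ 2 * ∑ i, ∑ j, a i j * (x i - z i) * (x j - z j) +
      2 * α * ∑ i, a i i - 2 * α * ∑ i, b i * (x i - z i) + c ≤ -1 := by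
  have hα1 : 1 ≤ α := le_trans (le_max_left _ _) hα
  have hα0 : 0 < α := by linarith
  -- the quadratic term
  have hquad : μ * (ρ / 4) ^ 2 ≤ ∑ i, ∑ j, a i j * (x i - z i) * (x j - z j) := by
    have h := hell (x - z)
    simp only [PiLp.sub_apply] at h
    refine le_trans ?_ h
    exact mul_le_mul_of_nonneg_left (pow_le_pow_left₀ (by positivity) hfar 2) hμ.le
  -- the trace term
  have htr : ∑ i, a i i ≤ N * C := by
    calc ∑ i, a i i ≤ ∑ _i : Fin N, C := Finset.sum_le_sum fun i _ ↦ (le_abs_self _).trans (ha i i)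
      _ = N * C := by simp
  -- the drift term
  have hcoord : ∀ i, |x i - z i| ≤ R := fun i ↦ by
    have : |(x - z) i| ≤ ‖x - z‖ := by
      simpa [Real.norm_eq_abs] using PiLp.norm_apply_le (x - z) i
    rw [PiLp.sub_apply] at this
    exact this.trans hnear
  have hdrift : -(∑ i, b i * (x i - z i)) ≤ N * C * R := by
    calc -(∑ i, b i * (x i - z i)) ≤ |∑ i, b i * (x i - z i)| := neg_le_abs _
      _ ≤ ∑ i, |b i * (x i - z i)| := Finset.abs_sum_le_sum_abs _ _
      _ ≤ ∑ _i : Fin N, C * R := Finset.sum_le_sum fun i _ ↦ by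
          rw [abs_mul]; exact mul_le_mul (hb i) (hcoord i) (abs_nonneg _) hC
      _ = N * C * R := by simp; ring
  -- assemble: bracket ≤ -4α² μ ρ²/16 + 2α N C + 2α N C R + C
  have hK : (8 * N * C + 8 * N * C * R + 4 * C + 4) * 4 / (μ * ρ ^ 2) ≤ α :=
    le_trans (le_max_right _ _) hα
  have hμρ : 0 < μ * ρ ^ 2 := by positivity
  rw [div_le_iff₀ hμρ] at hK
  have hN : (0 : ℝ) ≤ N := Nat.cast_nonneg N
  nlinarith [mul_le_mul_of_nonneg_left hquad (by positivity : (0 : ℝ) ≤ 4 * α ^ 2),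
    mul_le_mul_of_nonneg_left htr (by positivity : (0 : ℝ) ≤ 2 * α),
    mul_le_mul_of_nonneg_left hdrift (by positivity : (0 : ℝ) ≤ 2 * α),
    mul_nonneg hN hC, hα1, hK]

end Coordinates

end Literature.Analysis.PDE

end
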